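import Literature.NumberTheory.Automorphic.HidaTowerDiamondContinuity
import Literature.Algebra.Homology.GroupCohomologyCentralElement
import Literature.NumberTheory.GaloisRepresentations.KroneckerWeberTheorem
import Literature.NumberTheory.GaloisRepresentations.TateTwistFrobeniusProofs
import Literature.NumberTheory.GaloisRepresentations.OddAbsolutelyIrreducibleProofs
import Mathlib.NumberTheory.LSeries.PrimesInAP
import Mathlib.NumberTheory.Padics.HeightOneSpectrum
import Mathlib.LinearAlgebra.Matrix.Charpoly.Coeff
import HarnessLib

/-!
# `p`-adically automorphic Galois representations of `GL_n/ℚ`: the determinant of complex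
# conjugation is `(-1)^{n(n-1)/2}`; for `n = 2` they are odd

Topic `Literature/NumberTheory/Automorphic`; namespace `Literature.NumberTheory.Automorphic`,
grouping sub-namespaces `BigHeckeGLn` / `BigHeckeGLn.TameLevel` (the objects of
`CompletedCohomologyHeckeAlgebraGLn`, which this file continues) and `PadicallyAutomorphicDet`
(auxiliary ultrametric and Galois lemmas).  A *proofs* file: theorems only — no definition, no
named fact, no instance; axioms `propext`, `Classical.choice`, `Quot.sound`.

## Main results

* `BigHeckeGLn.TameLevel.IsPadicallyAutomorphic.coe_det_apply_of_isComplexConjugation`,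
  `….det_apply_of_isComplexConjugation`: for ANY prime `p`, ANY `S`-good tame level
  `𝒰 : TameLevel n ℚ p` of `GL_n/ℚ` and any continuous `ρ : Γ_ℚ → GL_n(ℚ̄_p)` which is `p`-ADICALLY
  AUTOMORPHIC of level `𝒰` (`TameLevel.IsPadicallyAutomorphic`: associated, at the good places, with a
  CONTINUOUS `ℚ̄_p`-point `x` of the completed-cohomology Hecke algebra
  `𝕋(K^p) = CompletedCohomologyHeckeAlgebraGLn 𝒰`), `det ρ(c) = (-1)^{n(n-1)/2}` for every complex
  conjugation `c ∈ Γ_ℚ`;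
* `BigHeckeGLn.TameLevel.IsPadicallyAutomorphic.isOdd`: for `n = 2` such `ρ` are ODD
  (`FramedGaloisRep.IsOdd`) — the oddness of the Galois representations attached to Hecke
  eigensystems in the (torsion, `p`-adically completed) cohomology of modular curves, with no
  hypothesis on `p`, on the level or on the residual representation.  In particular the hypothesis
  "`ρ` odd" of the odd-prime Fontaine–Mazur facts (`XZhang2024_fontaineMazurGL2_tateTwist`, …) is
  AUTOMATIC for the pro-modular `ρ` of `Pan2022_proModularDeRhamClassical_GL2Q`
  ([Pan2022LocallyAnalytic, §6.1.1]: "`ρ_λ` … an odd semi-simple Galois representation").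

## The proof (no Chebotarev density, no Galois representation over `𝕋(K^p)_𝔪`)

Let `e = n(n-1)/2` and `Θ = det ρ · ε_p^{-e} : Γ_ℚ → ℚ̄_pˣ` (continuous).  By association,
`det ρ(Frob_l) = (-1)^n P_l(0) = l^e x(T_{l,n})` and `ε_p(Frob_l) = l`, so `Θ(Frob_l) = x(T_{l,n})`
for every good prime `l` (`IsAssociated.coe_det_apply_of_isArithFrobAt`, `heckeFrobPoly_coeff_zero`).

1. **`T_{l,n}` is the identity deep in the tower for `l ≡ -1`**
   (`heckeOperator_heckeElement_apply_eq_one`).  `T_{l,n} = [U_r t U_r]`, `t = ϖ_l · 1` at `l`;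
   write `t = ι(γ)⁻¹ w'` with the CENTRAL global scalar `γ = (-1/l) · 1 ∈ GL_n(ℚ)`.  If
   `l ≡ -1 (mod ∏_{w ∈ S} q_w^N)` (`q_w` the rational prime under `w`, `N ≥ r` a congruence depth of
   `U` at the bad places, `exists_forall_ofLocal_mem`), the local components of `w' = ι(γ) t` are
   units at the good places and `≡ 1 (mod q_w^N)` scalars at the bad ones, so `w' ∈ U_r`
   (`mem_subgroup_of_localComponent'` — the placewise description `U = U_S × ∏_{v ∉ S} GL_n(𝒪_v)` —,
   `localScalar_mem_localCongruenceSubgroup`); hence `[U_r t U_r] = [U_r ι(γ)⁻¹ U_r]`, the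
   double-coset operator of the central `ι(γ)⁻¹` is the translation `π(ι(γ)⁻¹)`
   (`heckeAlgebra.coe_doubleCosetOperator_of_forall_commute`), i.e. the action of `γ` on the
   coefficients `Fun(GL_n(𝔸^∞)/U_r, ℤ/p^s)`, which induces the IDENTITY on
   `H^i(GL_n(ℚ), ·)` because `γ` is central (`Literature.Algebra.Homology.map_eq_id_of_central`,
   Serre, *Local Fields*, VII §5, Prop. 3) — `heckeOnCohomology_eq_id_of_mem_center`.  (For `n = 2`
   this is "`⟨-1⟩ = 1`: the nebentypus of weight-`2`-type cohomology is even".)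
2. **Continuity of `x`** (`exists_finset_norm_sub_lt`): `𝕋(K^p)` carries the topology induced from
   the product of the DISCRETE rings `End(H^i(X_{U_r}, ℤ/p^s))`, so for `δ > 0` the value `x(T)` is
   determined to within `δ` by finitely many components of `T`; with (1), `‖x(T_{l,n}) - 1‖ < δ` for
   all good `l ≡ -1` modulo a suitable modulus.
3. **Kronecker–Weber** (`PadicallyAutomorphicDet.exists_forall_smul_eq_self_imp_mem`, from the
   PROVED `KroneckerWeber_holds`): the open subgroup `Θ⁻¹{‖u - 1‖ < δ}` of `Γ_ℚ` contains the
   commutators, so its fixed field is finite abelian over `ℚ`, hence inside `ℚ(μ_m)`; as `c ↦ -1`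
   and `Frob_l ↦ l` in `Gal(ℚ(μ_m)/ℚ) ⊆ (ℤ/m)ˣ` (`modNCyclotomicCharacter_of_isComplexConjugation`,
   `modNCyclotomicCharacter_eq_residueCard_of_isArithFrobAt`), `c · Frob_l` fixes `μ_m` whenever
   `l ≡ -1 (mod m)`, whence `‖Θ(c) Θ(Frob_l) - 1‖ < δ`.
4. **Dirichlet** (Mathlib `Nat.forall_exists_prime_gt_and_eq_mod`) supplies primes
   `l ≡ -1 (mod m ∏ q_w^N)` beyond the bad places (`exists_prime_eq_neg_one_mod`); by the
   ultrametric inequality `‖Θ(c) - 1‖ < δ` for every `δ ∈ (0, 1]` (`norm_coe_sub_one_lt_of_frob`),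
   so `Θ(c) = 1` and `det ρ(c) = ε_p(c)^e = (-1)^e` (`GaloisRep.cyclotomicCharacter_of_isComplexConjugation`).

Places of `ℚ` are matched with rational primes through Mathlib's `Rat.HeightOneSpectrum.primesEquiv`
(`Rat.natCast_mem_asIdeal_iff_primesEquiv_dvd`, `Rat.asIdeal_primesEquiv_symm`,
`Rat.valued_natCast_self`, …; short copies of lemmas scattered in heavier files of the tree).

## References

* L. Pan, *On locally analytic vectors of the completed cohomology of modular curves*, Forum Math.
  Pi 10 (2022) = arXiv:2008.07099, §6.1.1 ("`ρ_λ : G_{ℚ,S} → GL₂(E)` … an odd semi-simple Galois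
  representation … whose determinant is `λ ∘ D_S`"). [Pan2022LocallyAnalytic]
* F. Calegari, M. Emerton, *Completed cohomology — a survey* (2011), §1.8 (Galois representations
  attached to completed cohomology of `GL₂/ℚ`). [CalegariEmerton2011]
* A. Caraiani, B. V. Le Hung, *On the image of complex conjugation in certain Galois
  representations*, Compos. Math. 152 (2016), Thm. 1.1 (the sign of `ρ(c)` for Galois
  representations from the cohomology of `GL_n`; its determinant is `(-1)^{⌊n/2⌋} = (-1)^{n(n-1)/2}`).
  [CaraianiLehung2016]
* J.-P. Serre, *Local Fields*, GTM 67 (1979), Ch. VII §5, Prop. 3 (inner automorphisms act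
  trivially on cohomology). [SerreLocalFields1979]
* G. Shimura, *Introduction to the arithmetic theory of automorphic functions* (1971), Prop. 3.17
  (central double cosets). [ShimuraIATAF1971]
* L. C. Washington, *Introduction to Cyclotomic Fields*, 2nd ed. (1997), Ch. 14, Thm. 14.1
  (Kronecker–Weber). [Washington1997]
-/

noncomputable section

open scoped NumberField
open NumberField IsDedekindDomain Filter Topology CategoryTheory

namespace Literature.NumberTheory.Automorphic

/-! ## 1. The double-coset operator of a central element is the translation by it -/

namespace heckeAlgebra

variable {k G : Type*} [CommRing k] [Group G] (L : Subgroup G)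
  [IsHeckeTriple (⊤ : Submonoid G) L L]

open MonoidAlgebra Representation in
/-- **The double-coset operator of a central element is the translation by it**: for `z`
central in `G`, `L z L = z L` is a single coset and `T_z [xL] = [x z L] = [z x L]`, i.e.
`T_z = π(z)` on `k[G ⧸ L]` (Shimura (1971), Prop. 3.17, the case `g = 1` of
`doubleCosetOperator_central_mul`). [folklore] -/
theorem coe_doubleCosetOperator_of_forall_commute {z : G} (hz : ∀ x : G, x * z = z * x) :
    ((doubleCosetOperator (k := k) L z : heckeAlgebra k G L) :
        Module.End k (MonoidAlgebra k (G ⧸ L))) = ofMulAction k G (G ⧸ L) z := by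
  set T : heckeAlgebra k G L := doubleCosetOperator (k := k) L z with hT
  -- `T [L] = [zL]`
  have hT1 : (T : Module.End k (MonoidAlgebra k (G ⧸ L))) (single ((1 : G) : G ⧸ L) 1) =
      single ((z : G) : G ⧸ L) 1 := by
    have h := doubleCosetIndicator_central_mul (k := k) L hz 1
    rw [mul_one, ← toVector_doubleCosetOperator L (1 : G), doubleCosetOperator_one, toVector_one,
      ofMulAction_single, MulAction.Quotient.smul_mk, smul_eq_mul, mul_one] at h
    rw [← toVector_apply, hT, toVector_doubleCosetOperator, h]
  have hcomm : ∀ g : G, ofMulAction k G (G ⧸ L) g * (T : Module.End k (MonoidAlgebra k (G ⧸ L))) =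
      (T : Module.End k (MonoidAlgebra k (G ⧸ L))) * ofMulAction k G (G ⧸ L) g :=
    (mem_heckeAlgebra_iff _).1 T.2
  refine LinearMap.ext fun f => ?_
  induction f using MonoidAlgebra.induction_linear with
  | zero => rw [map_zero, map_zero]
  | add x y hx hy => rw [map_add, map_add, hx, hy]
  | single m r =>
    induction m using QuotientGroup.induction_on with
    | H g =>
      have hs : (single (g : G ⧸ L) r : MonoidAlgebra k (G ⧸ L)) =
          r • ofMulAction k G (G ⧸ L) g (single ((1 : G) : G ⧸ L) 1) := by
        rw [ofMulAction_single, MulAction.Quotient.smul_mk, smul_eq_mul, mul_one, smul_single',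
          mul_one]
      rw [hs, map_smul, map_smul, ← Module.End.mul_apply, ← hcomm g, Module.End.mul_apply, hT1,
        ofMulAction_single, ofMulAction_single, ofMulAction_single, MulAction.Quotient.smul_mk,
        MulAction.Quotient.smul_mk, MulAction.Quotient.smul_mk, smul_eq_mul, smul_eq_mul,
        smul_eq_mul, mul_one, hz g]

end heckeAlgebra

namespace BigHeckeGLn

variable {n : ℕ} {K : Type} [Field K] [NumberField K]

/-! ## 2. Hecke operators of `(ι γ)⁻¹ u`, `γ` central, `u ∈ U`, are the identity on `H^i(X_U, k)` -/

section Central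

variable (U : Subgroup (FiniteAdelicGL n K)) (k : Type) [CommRing k]
  [IsHeckeTriple (⊤ : Submonoid (FiniteAdelicGL n K)) U U]

/-- For `γ ∈ GL_n(K)` with central image `ι γ ∈ GL_n(𝔸_K^∞)` and `u ∈ U`, the Hecke
correspondence `[U (ι γ)⁻¹ u U]` on `Fun(GL_n(𝔸_K^∞)/U, k)` IS the action of `γ`:
`U (ι γ)⁻¹ u U = (ι γ)⁻¹ U` is one coset and `f ↦ (xU ↦ f(x (ιγ)⁻¹ U)) = (xU ↦ f((ιγ)⁻¹ x U))`.
[folklore] -/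
theorem heckeEnd_apply_eq_levelRep {γ : GL (Fin n) K}
    (hγ : ∀ x : FiniteAdelicGL n K, x * globalEmbedding n K γ = globalEmbedding n K γ * x)
    {u : FiniteAdelicGL n K} (hu : u ∈ U) (f : levelModule U k) :
    heckeEnd U k ((globalEmbedding n K γ)⁻¹ * u) f = levelRep U k γ f := by
  have hz : ∀ x : FiniteAdelicGL n K,
      x * (globalEmbedding n K γ)⁻¹ = (globalEmbedding n K γ)⁻¹ * x := fun x => by
    rw [mul_inv_eq_iff_eq_mul, mul_assoc, hγ x, inv_mul_cancel_left]
  have hT : heckeAlgebra.doubleCosetOperator (k := k) U ((globalEmbedding n K γ)⁻¹ * u) =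
      heckeAlgebra.doubleCosetOperator U (globalEmbedding n K γ)⁻¹ := by
    conv_lhs => rw [← one_mul ((globalEmbedding n K γ)⁻¹ * u), ← mul_assoc]
    exact heckeAlgebra.doubleCosetOperator_mul_mul_eq U (one_mem U) hu
  rw [heckeEnd_apply, levelRep_apply, hT, heckeAlgebra.coe_doubleCosetOperator_of_forall_commute U hz]

/-- **The Hecke operator of `(ι γ)⁻¹ u` is the identity on `H^i(X_U, k)`** for `γ ∈ Z(GL_n(K))`
with central image and `u ∈ U`: it is induced by the action of the CENTRAL element `γ` on the
coefficients, which is trivial on group cohomology (`map_eq_id_of_central`, Serre, *Local Fields*,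
VII §5, Prop. 3). [folklore] -/
theorem heckeOnCohomology_eq_id_of_mem_center {γ : GL (Fin n) K}
    (hγc : γ ∈ Subgroup.center (GL (Fin n) K))
    (hγ : ∀ x : FiniteAdelicGL n K, x * globalEmbedding n K γ = globalEmbedding n K γ * x)
    {u : FiniteAdelicGL n K} (hu : u ∈ U) (i : ℕ) :
    heckeOnCohomology U k ((globalEmbedding n K γ)⁻¹ * u) i = LinearMap.id := by
  have h := Literature.Algebra.Homology.map_eq_id_of_central (Rep.of (levelRep U k)) hγc
    (Rep.ofHom (heckeIntertwining U k ((globalEmbedding n K γ)⁻¹ * u)))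
    (fun a => heckeEnd_apply_eq_levelRep U k hγ hu a) i
  unfold heckeOnCohomology
  rw [groupCohomology.functor_map, h]
  rfl

end Central

/-! ## 3. The constant coefficient of `P_v` and `det ρ(Frob_v)` for an associated `ρ` -/

open Polynomial in
/-- The constant coefficient of the Hecke–Frobenius polynomial (`n ≥ 1`):
`P(0) = (-1)^n q^{n(n-1)/2} a_n`. [folklore] -/
theorem heckeFrobPoly_coeff_zero (hn : 1 ≤ n) {A : Type*} [Ring A] (q : ℕ) (a : ℕ → A) :
    (heckeFrobPoly n q a).coeff 0 = (-1 : A) ^ n * (q : A) ^ (n * (n - 1) / 2) * a n := by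
  rw [heckeFrobPoly, coeff_add, coeff_X_pow, if_neg (by omega), zero_add, finsetSum_coeff,
    Finset.sum_eq_single n]
  · rw [Nat.sub_self, coeff_C_mul_X_pow, if_pos rfl]
  · intro i hi hne
    rw [coeff_C_mul_X_pow, if_neg]
    have : i < n := lt_of_le_of_ne (Finset.mem_Icc.1 hi).2 hne
    omega
  · intro h
    exact absurd (Finset.mem_Icc.2 ⟨hn, le_rfl⟩) h

namespace TameLevel

variable {p : ℕ} [Fact p.Prime]

/-- **`det ρ(Frob_v) = q_v^{n(n-1)/2} · x(T_{v,n})`** for `ρ` associated with the eigensystem `x`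
and `v ∉ S` (`n ≥ 1`): the determinant is `(-1)^n P_v(0)`. [folklore] -/
theorem IsAssociated.coe_det_apply_of_isArithFrobAt (𝒰 : TameLevel n K p) (hn : 1 ≤ n)
    {A : Type*} [CommRing A] [TopologicalSpace A]
    {x : CompletedCohomologyHeckeAlgebraGLn 𝒰 →+* A}
    {ρ : Literature.NumberTheory.GaloisRepresentations.FramedGaloisRep K A n} (hx : 𝒰.IsAssociated x ρ)
    {v : HeightOneSpectrum (𝓞 K)} (hv : v ∉ 𝒰.bad)
    {𝔓 : Ideal (Literature.NumberTheory.GaloisRepresentations.absIntegers (𝓞 K) K)}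
    (h𝔓 : 𝔓 ∈ v.primesAbove) {σ : Field.absoluteGaloisGroup K} (hσ : IsArithFrobAt (𝓞 K) σ 𝔓) :
    ((Matrix.GeneralLinearGroup.det (ρ σ) : Aˣ) : A) =
      ((Ideal.absNorm v.asIdeal : ℕ) : A) ^ (n * (n - 1) / 2) * x (𝒰.heckeT v n) := by
  have hchar : Literature.NumberTheory.GaloisRepresentations.FramedRep.charpoly ρ σ =
      heckeFrobPoly n (Ideal.absNorm v.asIdeal) (fun i => x (𝒰.heckeT v i)) :=
    (hx v hv).2 𝔓 h𝔓 σ hσ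
  rw [Matrix.GeneralLinearGroup.val_det_apply, Matrix.det_eq_sign_charpoly_coeff]
  change (-1 : A) ^ Fintype.card (Fin n) *
    (Literature.NumberTheory.GaloisRepresentations.FramedRep.charpoly ρ σ).coeff 0 = _
  rw [hchar, heckeFrobPoly_coeff_zero hn, Fintype.card_fin, ← mul_assoc, ← mul_assoc,
    ← pow_add, ← two_mul, pow_mul, neg_one_sq, one_pow, one_mul]

end TameLevel

/-! ## 4. Places of `ℚ` and rational primes (Mathlib `Rat.HeightOneSpectrum.primesEquiv`) -/

section RatPlaces

open Rat.HeightOneSpectrum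

/-- A natural number lies in the finite place `v` of `ℚ` iff the prime under `v` divides it
(`Rat.HeightOneSpectrum.natGenerator_dvd_iff`). [folklore] -/
theorem Rat.natCast_mem_asIdeal_iff_primesEquiv_dvd (v : HeightOneSpectrum (𝓞 ℚ)) (m : ℕ) :
    (m : 𝓞 ℚ) ∈ v.asIdeal ↔ ((primesEquiv v : Nat.Primes) : ℕ) ∣ m := by
  change _ ↔ natGenerator v ∣ m
  rw [natGenerator_dvd_iff, Ideal.mem_map_of_equiv]
  constructor
  · intro h
    exact ⟨m, h, map_natCast _ m⟩
  · rintro ⟨x, hx, hxn⟩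
    have : x = m := (Rat.IsIntegralClosure.intEquiv (𝓞 ℚ)).injective (by rw [hxn, map_natCast])
    rwa [this] at hx

/-- The place of `ℚ` attached to the rational prime `q` is the ideal `(q)` of `𝓞 ℚ`. [folklore] -/
theorem Rat.asIdeal_primesEquiv_symm (q : Nat.Primes) :
    ((primesEquiv (R := 𝓞 ℚ)).symm q).asIdeal = Ideal.span {((q : ℕ) : 𝓞 ℚ)} := by
  change Ideal.map (Rat.IsIntegralClosure.intEquiv (𝓞 ℚ)).symm (Ideal.span {((q : ℕ) : ℤ)}) = _
  rw [Ideal.map_span, Set.image_singleton]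
  congr 2
  exact map_natCast _ _

/-- `|l|_v = |ϖ_v|` at the place `v` of `ℚ` under the rational prime `l`. [folklore] -/
theorem Rat.valued_natCast_self {v : HeightOneSpectrum (𝓞 ℚ)} {q : ℕ} (hq : q.Prime)
    (hv : ((primesEquiv v : Nat.Primes) : ℕ) = q) :
    Valued.v (algebraMap ℚ (v.adicCompletion ℚ) (q : ℚ)) = WithZero.exp (-1 : ℤ) := by
  have hv' : v = (primesEquiv (R := 𝓞 ℚ)).symm ⟨q, hq⟩ := by
    rw [Equiv.eq_symm_apply]
    exact Subtype.ext hv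
  have hq0 : ((q : 𝓞 ℚ)) ≠ 0 := by exact_mod_cast hq.ne_zero
  have hspan : v.asIdeal = Ideal.span {((q : ℕ) : 𝓞 ℚ)} := by
    rw [hv']
    exact Rat.asIdeal_primesEquiv_symm ⟨q, hq⟩
  refine (HeightOneSpectrum.valuedAdicCompletion_eq_valuation' v (q : ℚ)).trans ?_
  rw [← map_natCast (algebraMap (𝓞 ℚ) ℚ), HeightOneSpectrum.valuation_of_algebraMap]
  exact HeightOneSpectrum.intValuation_singleton (v := v) hq0 hspan

/-- `|l|_w = 1` at every place `w` of `ℚ` other than the one under the rational prime `l`.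
[folklore] -/
theorem Rat.valued_natCast_of_ne {q : ℕ} (hq : q.Prime) {w : HeightOneSpectrum (𝓞 ℚ)}
    (hw : ((primesEquiv w : Nat.Primes) : ℕ) ≠ q) :
    Valued.v (algebraMap ℚ (w.adicCompletion ℚ) (q : ℚ)) = 1 := by
  have hnot : ((q : 𝓞 ℚ)) ∉ w.asIdeal := by
    intro h
    apply hw
    have hdvd := (Rat.natCast_mem_asIdeal_iff_primesEquiv_dvd w q).1 h
    exact (Nat.prime_dvd_prime_iff_eq (primesEquiv w).2 hq).1 hdvd
  refine (HeightOneSpectrum.valuedAdicCompletion_eq_valuation' w (q : ℚ)).trans ?_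
  rw [← map_natCast (algebraMap (𝓞 ℚ) ℚ), HeightOneSpectrum.valuation_eq_one_iff_notMem]
  exact hnot

/-- `|m|_w ≤ |ϖ_w|^N` when `q_w^N ∣ m` (`q_w` the rational prime under `w`). [folklore] -/
theorem Rat.valued_natCast_le_exp_neg_of_pow_dvd {w : HeightOneSpectrum (𝓞 ℚ)} {N m : ℕ}
    (h : ((primesEquiv w : Nat.Primes) : ℕ) ^ N ∣ m) :
    Valued.v (algebraMap ℚ (w.adicCompletion ℚ) (m : ℚ)) ≤ WithZero.exp (-(N : ℤ)) := by
  obtain ⟨r, hr⟩ := h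
  set q : ℕ := ((primesEquiv w : Nat.Primes) : ℕ) with hq
  have hqprime : q.Prime := (primesEquiv w).2
  have hqv : Valued.v (algebraMap ℚ (w.adicCompletion ℚ) (q : ℚ)) ≤ WithZero.exp (-1 : ℤ) := by
    have hmem : ((q : 𝓞 ℚ)) ∈ w.asIdeal :=
      (Rat.natCast_mem_asIdeal_iff_primesEquiv_dvd w q).2 (dvd_refl _)
    have hlt : Valued.v (algebraMap ℚ (w.adicCompletion ℚ) (q : ℚ)) < 1 := by
      refine lt_of_eq_of_lt (HeightOneSpectrum.valuedAdicCompletion_eq_valuation' w (q : ℚ)) ?_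
      rw [← map_natCast (algebraMap (𝓞 ℚ) ℚ), HeightOneSpectrum.valuation_lt_one_iff_mem]
      exact hmem
    have hq0 : algebraMap ℚ (w.adicCompletion ℚ) (q : ℚ) ≠ 0 := by
      rw [map_ne_zero]
      exact_mod_cast hqprime.ne_zero
    have hne : Valued.v (algebraMap ℚ (w.adicCompletion ℚ) (q : ℚ)) ≠ 0 :=
      (Valuation.ne_zero_iff _).2 hq0
    obtain ⟨k, hk⟩ : ∃ k : ℤ, Valued.v (algebraMap ℚ (w.adicCompletion ℚ) (q : ℚ)) = WithZero.exp k :=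
      ⟨_, (WithZero.exp_log hne).symm⟩
    rw [hk] at hlt ⊢
    rw [← WithZero.exp_zero, WithZero.exp_lt_exp] at hlt
    rw [WithZero.exp_le_exp]
    omega
  have hrv : Valued.v (algebraMap ℚ (w.adicCompletion ℚ) (r : ℚ)) ≤ 1 := by
    refine le_of_eq_of_le (HeightOneSpectrum.valuedAdicCompletion_eq_valuation' w (r : ℚ)) ?_
    rw [← map_natCast (algebraMap (𝓞 ℚ) ℚ)]
    exact HeightOneSpectrum.valuation_le_one w _
  have hm : (m : ℚ) = (q : ℚ) ^ N * (r : ℚ) := by rw [hr]; push_cast; rfl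
  rw [hm, map_mul, map_pow, map_mul, map_pow]
  calc Valued.v (algebraMap ℚ (w.adicCompletion ℚ) (q : ℚ)) ^ N *
        Valued.v (algebraMap ℚ (w.adicCompletion ℚ) (r : ℚ))
      ≤ (WithZero.exp (-1 : ℤ)) ^ N * 1 := mul_le_mul' (pow_le_pow_left' hqv N) hrv
    _ = WithZero.exp (-(N : ℤ)) := by
        rw [mul_one, ← WithZero.exp_nsmul]
        congr 1
        simp

end RatPlaces

/-! ## 5. `T_{l,n}` is the identity deep in the tower when `l ≡ -1` modulo a high level -/

namespace TameLevel

variable {p : ℕ} [Fact p.Prime]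

open Rat.HeightOneSpectrum

omit [Fact p.Prime] in
/-- A scalar matrix `e · 1 ∈ GL_n(K_w)` with `|e|_w = 1` lies in `GL_n(𝒪_w)`. [folklore] -/
theorem glDiagonal_const_mem_valuedCongruenceSubgroup_one (w : HeightOneSpectrum (𝓞 K))
    (e : (w.adicCompletion K)ˣ) (he : Valued.v (e : w.adicCompletion K) = 1) :
    glDiagonal n (w.adicCompletion K) (fun _ => e) ∈
      valuedCongruenceSubgroup (Fin n) (1 : WithZero (Multiplicative ℤ)) := by
  have hdiag : ∀ (e' : (w.adicCompletion K)ˣ) (i j : Fin n), Valued.v ((e' : w.adicCompletion K)) ≤ 1 →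
      Valued.v ((glDiagonal n (w.adicCompletion K) (fun _ => e') :
        Matrix (Fin n) (Fin n) (w.adicCompletion K)) i j) ≤ 1 := by
    intro e' i j he'
    rw [coe_glDiagonal, Matrix.diagonal_apply]
    split_ifs
    · exact he'
    · simp
  refine (mem_valuedCongruenceSubgroup_iff (m := Fin n)).2 ⟨fun i j => hdiag e i j he.le,
    fun i j => ?_, fun i j => ?_⟩
  · rw [← map_inv]
    exact hdiag e⁻¹ i j (by rw [Units.val_inv_eq_inv_val, map_inv₀, he, inv_one])
  · rw [Matrix.sub_apply, coe_glDiagonal, Matrix.diagonal_apply, Matrix.one_apply]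
    split_ifs
    · exact (Valued.v.map_sub _ _).trans (max_le he.le (by simp))
    · simp

/-- **`T_{l,n}` is the identity on `H^i(X_{U_r}, ℤ/p^s)` for `r ≤ N` when `l ≡ -1` modulo
`∏_{w ∈ S} q_w^N`** (`q_w` the rational prime under the bad place `w`; `N ≥ 1` a congruence depth
at which `U` contains `ι_w(K_w(q_w^N))` for all bad `w`).  Indeed `t_{l,n} = ι(γ)⁻¹ · w'` with
`γ = (-1/l) · 1 ∈ Z(GL_n(ℚ))` and `w' = ι(γ) t_{l,n} ∈ U_r`: the local components of `w'` are the
scalar `-1/l ≡ 1` at the bad places (so `w' ∈ U` placewise, `mem_subgroup_of_localComponent'`, and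
`w'` is `p^r`-deep above `p`), the unit scalar `-1/l` at the good places `≠ l`, and the unit
`-ϖ_l/l` at `l`; and the Hecke operator of `ι(γ)⁻¹ w'` is the identity
(`heckeOnCohomology_eq_id_of_mem_center`).  This is the statement "the diamond operator
`⟨-1⟩ = S_l · l⁻¹…` is trivial", i.e. `-1 ∈ GL_n(ℚ)` acts trivially on `H^•(GL_n(ℚ), ·)`.
[folklore] -/
theorem heckeOperator_heckeElement_apply_eq_one (𝒰 : TameLevel n ℚ p) {N : ℕ} (hN : 1 ≤ N)
    (hU : ∀ w ∈ 𝒰.bad, ∀ g ∈ localCongruenceSubgroup n ℚ w N, ofLocal n ℚ w g ∈ 𝒰.subgroup)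
    {l : ℕ} (hl : l.Prime) {v : HeightOneSpectrum (𝓞 ℚ)}
    (hvl : ((primesEquiv v : Nat.Primes) : ℕ) = l) (hv : v ∉ 𝒰.bad)
    (hcong : ∀ w ∈ 𝒰.bad, ((primesEquiv w : Nat.Primes) : ℕ) ^ N ∣ l + 1)
    (idx : ℕ × ℕ × ℕ) (hidx : idx.1 ≤ N) :
    𝒰.heckeOperator (heckeElement n ℚ v n) idx = 1 := by
  classical
  have hl0 : (l : ℚ) ≠ 0 := by exact_mod_cast hl.ne_zero
  have hne_of_ne : ∀ w : HeightOneSpectrum (𝓞 ℚ), w ≠ v → ((primesEquiv w : Nat.Primes) : ℕ) ≠ l :=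
    fun w hw h => hw (primesEquiv.injective (Subtype.ext (h.trans hvl.symm)))
  -- the compensating global scalar `γ = (-1/l) · 1`
  set a : ℚˣ := Units.mk0 (-(l : ℚ)⁻¹) (neg_ne_zero.2 (inv_ne_zero hl0)) with ha
  set γ : GL (Fin n) ℚ := Matrix.GeneralLinearGroup.scalar (Fin n) a with hγdef
  have hγc : γ ∈ Subgroup.center (GL (Fin n) ℚ) :=
    Subgroup.mem_center_iff.2 fun g => (Matrix.GeneralLinearGroup.scalar_commute a g).symm
  have hcoe : ((globalEmbedding n ℚ γ : FiniteAdelicGL n ℚ) :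
      Matrix (Fin n) (Fin n) (FiniteAdeleRing (𝓞 ℚ) ℚ)) =
      Matrix.scalar (Fin n) (algebraMap ℚ (FiniteAdeleRing (𝓞 ℚ) ℚ) (a : ℚ)) := by
    refine Matrix.ext fun i j => ?_
    change algebraMap ℚ (FiniteAdeleRing (𝓞 ℚ) ℚ) ((γ : Matrix (Fin n) (Fin n) ℚ) i j) = _
    rw [hγdef, Matrix.GeneralLinearGroup.coe_scalar, Matrix.scalar_apply, Matrix.scalar_apply,
      Matrix.diagonal_apply, Matrix.diagonal_apply]
    split_ifs
    · rfl
    · exact map_zero _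
  have hγ : ∀ x : FiniteAdelicGL n ℚ, x * globalEmbedding n ℚ γ = globalEmbedding n ℚ γ * x := by
    intro x
    refine Units.ext ?_
    rw [Units.val_mul, Units.val_mul, hcoe]
    exact ((Matrix.scalar_commute _ (fun r' => Commute.all _ r') _).eq).symm
  -- `w' = ι(γ) t_{l,n}` and its local components
  set t : FiniteAdelicGL n ℚ := heckeElement n ℚ v n with ht
  set w' : FiniteAdelicGL n ℚ := globalEmbedding n ℚ γ * t with hw'
  have hloc_ne : ∀ w : HeightOneSpectrum (𝓞 ℚ), w ≠ v →
      localComponent n ℚ w w' = localScalar w a := by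
    intro w hw
    rw [hw', map_mul, hγdef, localComponent_globalEmbedding_scalar, ht, heckeElement_eq_ofLocal,
      localComponent_ofLocal_of_ne hw, mul_one]
  have hloc_self : localComponent n ℚ v w' =
      glDiagonal n (v.adicCompletion ℚ) (fun _ =>
        Units.map (algebraMap ℚ (v.adicCompletion ℚ) : ℚ →* v.adicCompletion ℚ) a * uniformizerAt v) := by
    rw [hw', map_mul, hγdef, localComponent_globalEmbedding_scalar, ht,
      localComponent_heckeElement_self, cutDiag_self, localScalar, ← map_mul]
    rfl
  -- valuations of `a = -1/l`
  have ha_coe : (a : ℚ) = -(l : ℚ)⁻¹ := rfl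
  have hval_self : Valued.v (((Units.map (algebraMap ℚ (v.adicCompletion ℚ) : ℚ →* v.adicCompletion ℚ) a *
      uniformizerAt v : (v.adicCompletion ℚ)ˣ) : v.adicCompletion ℚ)) = 1 := by
    rw [Units.val_mul, map_mul, valued_coe_uniformizerAt, Units.coe_map, MonoidHom.coe_coe, ha_coe,
      map_neg, Valuation.map_neg, map_inv₀, map_inv₀, Rat.valued_natCast_self hl hvl,
      ← WithZero.exp_neg, ← WithZero.exp_add]
    simp
  have hval_ne : ∀ w : HeightOneSpectrum (𝓞 ℚ), w ≠ v →
      Valued.v (algebraMap ℚ (w.adicCompletion ℚ) (a : ℚ)) = 1 := by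
    intro w hw
    rw [ha_coe, map_neg, Valuation.map_neg, map_inv₀, map_inv₀,
      Rat.valued_natCast_of_ne hl (hne_of_ne w hw), inv_one]
  have hval_sub : ∀ w : HeightOneSpectrum (𝓞 ℚ), w ≠ v → ∀ {m : ℕ},
      ((primesEquiv w : Nat.Primes) : ℕ) ^ m ∣ l + 1 →
      Valued.v (algebraMap ℚ (w.adicCompletion ℚ) (a : ℚ) - 1) ≤ WithZero.exp (-(m : ℤ)) := by
    intro w hw m hm
    have hrw : algebraMap ℚ (w.adicCompletion ℚ) (a : ℚ) - 1 =
        -(algebraMap ℚ (w.adicCompletion ℚ) ((l + 1 : ℕ) : ℚ) *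
          (algebraMap ℚ (w.adicCompletion ℚ) (l : ℚ))⁻¹) := by
      rw [← map_one (algebraMap ℚ (w.adicCompletion ℚ)), ← map_sub, ← map_inv₀, ← map_mul, ← map_neg]
      congr 1
      rw [ha_coe]
      field_simp
      push_cast
      ring
    rw [hrw, Valuation.map_neg, map_mul, map_inv₀, Rat.valued_natCast_of_ne hl (hne_of_ne w hw),
      inv_one, mul_one]
    exact Rat.valued_natCast_le_exp_neg_of_pow_dvd hm
  -- `w' ∈ U`
  have hw'U : w' ∈ 𝒰.subgroup := by
    refine mem_subgroup_of_localComponent' 𝒰 (fun w hw => ?_) fun w hw => ?_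
    · by_cases hwv : w = v
      · subst hwv
        rw [hloc_self]
        exact glDiagonal_const_mem_valuedCongruenceSubgroup_one w _ hval_self
      · rw [hloc_ne w hwv, localScalar]
        exact glDiagonal_const_mem_valuedCongruenceSubgroup_one w _
          (by rw [Units.coe_map, MonoidHom.coe_coe]; exact hval_ne w hwv)
    · have hwv : w ≠ v := fun h => hv (h ▸ hw)
      rw [hloc_ne w hwv]
      exact hU w hw _ (localScalar_mem_localCongruenceSubgroup w a hN (hval_sub w hwv (hcong w hw)))
  -- `w' ∈ U_{idx.1}`
  have hw'tower : w' ∈ 𝒰.tower idx.1 := by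
    refine Subgroup.mem_inf.2 ⟨hw'U, Subgroup.mem_iInf.2 fun u => Subgroup.mem_comap.2 ?_⟩
    have hubad : u.1 ∈ 𝒰.bad := 𝒰.mem_bad_of_mem u.1 u.2
    have huv : u.1 ≠ v := fun h => hv (h ▸ hubad)
    rw [hloc_ne u.1 huv]
    have hmem : localScalar (n := n) u.1 a ∈ localCongruenceSubgroup n ℚ u.1 (max idx.1 1) :=
      localScalar_mem_localCongruenceSubgroup u.1 a (le_max_right _ _)
        (hval_sub u.1 huv ((pow_dvd_pow _ (max_le hidx hN)).trans (hcong u.1 hubad)))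
    exact valuedCongruenceSubgroup_mono (Fin n)
      (WithZero.exp_le_exp.2 (by simp)) hmem
  -- `t = ι(γ)⁻¹ w'` and the Hecke operator of `ι(γ)⁻¹ w'` is the identity
  have htw : t = (globalEmbedding n ℚ γ)⁻¹ * w' := by rw [hw', inv_mul_cancel_left]
  show heckeOnCohomology (𝒰.tower idx.1) (ZMod (p ^ idx.2.1)) t idx.2.2 = 1
  rw [htw, heckeOnCohomology_eq_id_of_mem_center (𝒰.tower idx.1) (ZMod (p ^ idx.2.1)) hγc hγ
    hw'tower idx.2.2]
  rfl

/-! ## 6. Continuity of a point of `𝕋(K^p)`: agreement at finitely many indices -/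

/-- **A continuous point of `𝕋(K^p)` only sees finitely many indices at each precision**: for a
continuous `x : 𝕋(K^p) → ℚ̄_p` and `δ > 0` there is a finite set `F` of indices `(r,s,i)` such
that `‖x T - x T'‖ < δ` whenever `T, T' ∈ 𝕋(K^p)` have the same components at the indices in `F`
(the topology of `𝕋(K^p)` is induced from the product of the DISCRETE rings
`End(H^i(X_{U_r}, ℤ/p^s))`). [folklore] -/
theorem exists_finset_norm_sub_lt (𝒰 : TameLevel n K p)
    {x : CompletedCohomologyHeckeAlgebraGLn 𝒰 →+* PadicAlgCl p} (hx : Continuous x) {δ : ℝ}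
    (hδ : 0 < δ) :
    ∃ F : Finset (ℕ × ℕ × ℕ), ∀ T T' : CompletedCohomologyHeckeAlgebraGLn 𝒰,
      (∀ idx ∈ F, (T : 𝒰.bigEnd) idx = (T' : 𝒰.bigEnd) idx) → ‖x T - x T'‖ < δ := by
  have hV : IsOpen (x ⁻¹' Metric.ball 0 δ) := Metric.isOpen_ball.preimage hx
  obtain ⟨W, hW, hWV⟩ := isOpen_induced_iff.1 hV
  have h0W : ((0 : CompletedCohomologyHeckeAlgebraGLn 𝒰) : 𝒰.bigEnd) ∈ W := by
    have h0 : (0 : CompletedCohomologyHeckeAlgebraGLn 𝒰) ∈ x ⁻¹' Metric.ball 0 δ := by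
      rw [Set.mem_preimage, map_zero]
      exact Metric.mem_ball_self hδ
    rw [← hWV] at h0
    exact h0
  obtain ⟨I, u, hu, hIu⟩ := isOpen_pi_iff.1 hW _ h0W
  refine ⟨I, fun T T' hTT' => ?_⟩
  have hmem : ((T - T' : CompletedCohomologyHeckeAlgebraGLn 𝒰) : 𝒰.bigEnd) ∈ W := by
    refine hIu (Set.mem_pi.2 fun idx hidx => ?_)
    have h0 : ((0 : CompletedCohomologyHeckeAlgebraGLn 𝒰) : 𝒰.bigEnd) idx ∈ u idx := (hu idx hidx).2
    rw [ZeroMemClass.coe_zero, Pi.zero_apply] at h0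
    rw [AddSubgroupClass.coe_sub, Pi.sub_apply, hTT' idx hidx, sub_self]
    exact h0
  have hball : (T - T') ∈ x ⁻¹' Metric.ball 0 δ := by
    rw [← hWV]
    exact hmem
  rw [Set.mem_preimage, map_sub, Metric.mem_ball, dist_zero_right] at hball
  exact hball

end TameLevel

end BigHeckeGLn

/-! ## 7. The Galois side: ultrametric balls, Kronecker–Weber, roots of unity -/

namespace PadicallyAutomorphicDet

variable {p : ℕ} [Fact p.Prime]

/-- `‖a - 1‖ < 1 ⟹ ‖a‖ = 1` in `ℚ̄_p`. [folklore] -/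
theorem norm_eq_one_of_norm_sub_one_lt_one {a : PadicAlgCl p} (h : ‖a - 1‖ < 1) : ‖a‖ = 1 := by
  have h1 := IsUltrametricDist.norm_add_le_max (a - 1) 1
  rw [sub_add_cancel, norm_one] at h1
  have h2 := IsUltrametricDist.norm_add_le_max a (-(a - 1))
  rw [norm_neg, show a + -(a - 1) = 1 by ring, norm_one] at h2
  refine le_antisymm ?_ ?_
  · rcases le_max_iff.1 h1 with h3 | h3
    · exact h3.trans h.le
    · exact h3
  · rcases le_max_iff.1 h2 with h3 | h3
    · exact h3
    · exact absurd (h3.trans_lt h) (lt_irrefl _)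

/-- If `‖a b - 1‖ < δ` and `‖b - 1‖ < δ ≤ 1` in `ℚ̄_p` then `‖a - 1‖ < δ` (ultrametric inequality:
`a - 1 = (ab - 1) - a (b - 1)` and `‖a‖ = 1`). [folklore] -/
theorem norm_sub_one_lt_of_norm_mul_sub_one_lt {a b : PadicAlgCl p} {δ : ℝ} (hδ : δ ≤ 1)
    (hab : ‖a * b - 1‖ < δ) (hb : ‖b - 1‖ < δ) : ‖a - 1‖ < δ := by
  have hb1 : ‖b‖ = 1 := norm_eq_one_of_norm_sub_one_lt_one (hb.trans_le hδ)
  have hab1 : ‖a * b‖ = 1 := norm_eq_one_of_norm_sub_one_lt_one (hab.trans_le hδ)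
  have ha1 : ‖a‖ = 1 := by
    have : ‖a‖ * ‖b‖ = 1 := by rw [← norm_mul, hab1]
    rwa [hb1, mul_one] at this
  have heq : a - 1 = (a * b - 1) + -(a * (b - 1)) := by ring
  rw [heq]
  refine (IsUltrametricDist.norm_add_le_max _ _).trans_lt (max_lt hab ?_)
  rw [norm_neg, norm_mul, ha1, one_mul]
  exact hb

/-- An element of `ℚ̄_p` within every `δ ∈ (0, 1]` of `1` is `1`. [folklore] -/
theorem eq_one_of_forall_norm_sub_one_lt {a : PadicAlgCl p}
    (h : ∀ δ : ℝ, 0 < δ → δ ≤ 1 → ‖a - 1‖ < δ) : a = 1 := by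
  by_contra hne
  have hpos : 0 < ‖a - 1‖ := norm_pos_iff.2 (sub_ne_zero.2 hne)
  have := h (min ‖a - 1‖ 1) (lt_min hpos one_pos) (min_le_right _ _)
  exact absurd (this.trans_le (min_le_left _ _)) (lt_irrefl _)

/-- **The multiplicative balls `N_δ = {u ∈ ℚ̄_pˣ : ‖u - 1‖ < δ}` (`0 < δ ≤ 1`) are open subgroups
of `ℚ̄_pˣ`** (ultrametric inequality).  Stated as an existence theorem (no definition is
introduced). [folklore] -/
theorem exists_subgroup_norm_sub_one_lt (p : ℕ) [Fact p.Prime] (δ : ℝ) (hδ0 : 0 < δ) (hδ1 : δ ≤ 1) :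
    ∃ N : Subgroup (PadicAlgCl p)ˣ,
      (∀ u : (PadicAlgCl p)ˣ, u ∈ N ↔ ‖(u : PadicAlgCl p) - 1‖ < δ) ∧
        IsOpen ((N : Subgroup (PadicAlgCl p)ˣ) : Set (PadicAlgCl p)ˣ) := by
  refine ⟨{ carrier := {u | ‖((u : (PadicAlgCl p)ˣ) : PadicAlgCl p) - 1‖ < δ}
            one_mem' := ?_
            mul_mem' := ?_
            inv_mem' := ?_ }, fun u => Iff.rfl, ?_⟩
  · intro u v hu hv
    change ‖(u : PadicAlgCl p) - 1‖ < δ at hu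
    change ‖(v : PadicAlgCl p) - 1‖ < δ at hv
    show ‖((u * v : (PadicAlgCl p)ˣ) : PadicAlgCl p) - 1‖ < δ
    have hu1 : ‖(u : PadicAlgCl p)‖ = 1 := norm_eq_one_of_norm_sub_one_lt_one (hu.trans_le hδ1)
    have heq : ((u * v : (PadicAlgCl p)ˣ) : PadicAlgCl p) - 1 =
        (u : PadicAlgCl p) * ((v : PadicAlgCl p) - 1) + ((u : PadicAlgCl p) - 1) := by
      rw [Units.val_mul]; ring
    rw [heq]
    refine (IsUltrametricDist.norm_add_le_max _ _).trans_lt (max_lt ?_ hu)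
    rw [norm_mul, hu1, one_mul]
    exact hv
  · show ‖((1 : (PadicAlgCl p)ˣ) : PadicAlgCl p) - 1‖ < δ
    rw [Units.val_one, sub_self, norm_zero]
    exact hδ0
  · intro u hu
    change ‖(u : PadicAlgCl p) - 1‖ < δ at hu
    show ‖((u⁻¹ : (PadicAlgCl p)ˣ) : PadicAlgCl p) - 1‖ < δ
    have hu1 : ‖(u : PadicAlgCl p)‖ = 1 := norm_eq_one_of_norm_sub_one_lt_one (hu.trans_le hδ1)
    have heq : ((u⁻¹ : (PadicAlgCl p)ˣ) : PadicAlgCl p) - 1 =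
        -(((u⁻¹ : (PadicAlgCl p)ˣ) : PadicAlgCl p) * ((u : PadicAlgCl p) - 1)) := by
      rw [mul_sub, mul_one, Units.inv_mul, neg_sub]
    have hinv : ‖((u⁻¹ : (PadicAlgCl p)ˣ) : PadicAlgCl p)‖ = 1 := by
      have h := congrArg norm (Units.inv_mul u : ((u⁻¹ : (PadicAlgCl p)ˣ) : PadicAlgCl p) * u = 1)
      rw [norm_mul, hu1, mul_one, norm_one] at h
      exact h
    rw [heq, norm_neg, norm_mul, hinv, one_mul]
    exact hu
  · exact isOpen_lt (continuous_norm.comp (Units.continuous_val.sub continuous_const)) continuous_const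

open Literature.NumberTheory.GaloisRepresentations Field

omit [Fact p.Prime] in
/-- **Kronecker–Weber ⇒ an open subgroup of `Γ_K` with abelian quotient contains
`Gal(K̄/K(μ_m))` for some `m ≥ 1`** (`K` a field with the Kronecker–Weber property, e.g. `K = ℚ` by
the PROVED `KroneckerWeber_holds`): the fixed field of the subgroup is a finite abelian Galois
extension of `K` inside `K̄`, hence inside `K(μ_m)`.  (The argument of
`exists_forall_smul_eq_self_imp_eq_one_of_isKroneckerWeber` of
`DeligneSerreWeightOneIrreducibleKroneckerWeberProofs` — there for the kernel of a character —,
reproduced for a subgroup containing the commutators so as to keep this file's imports inside the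
Galois-representation / completed-cohomology vocabulary; that module sits on the Deligne–Serre and
`L`-function cones.) [cite: Washington1997, Ch. 14, Thm. 14.1] -/
theorem exists_forall_smul_eq_self_imp_mem {K : Type*} [Field K] [CharZero K]
    (hKW : IsKroneckerWeber K) (U : Subgroup (absoluteGaloisGroup K))
    (hker : IsOpen ((U : Subgroup (absoluteGaloisGroup K)) : Set (absoluteGaloisGroup K)))
    (hab : ∀ a b : absoluteGaloisGroup K, a * b * a⁻¹ * b⁻¹ ∈ U) :
    ∃ m : ℕ, 0 < m ∧ ∀ σ : absoluteGaloisGroup K,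
      (∀ ζ : AlgebraicClosure K, ζ ^ m = 1 → σ • ζ = ζ) → σ ∈ U := by
  classical
  haveI hUnormal : U.Normal := ⟨fun h hh g => by
    have h1 := U.mul_mem (hab g h) hh
    rwa [inv_mul_cancel_right] at h1⟩
  -- transported to `K̄ ≃ₐ[K] K̄` along the identity
  let U' : Subgroup (AlgebraicClosure K ≃ₐ[K] AlgebraicClosure K) :=
    U.map (absoluteGaloisGroup.toAlgEquiv K).toMonoidHom
  have hU'open : IsOpen (U' : Set (AlgebraicClosure K ≃ₐ[K] AlgebraicClosure K)) := by
    have hHeq : (U' : Set (AlgebraicClosure K ≃ₐ[K] AlgebraicClosure K)) =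
        (absoluteGaloisGroup.toAlgEquiv K).symm ⁻¹' U := by
      ext f
      rw [SetLike.mem_coe, Set.mem_preimage, SetLike.mem_coe]
      exact Subgroup.mem_map_equiv
    have hcont : Continuous (absoluteGaloisGroup.toAlgEquiv K).symm := continuous_id
    rw [hHeq]
    exact hker.preimage hcont
  have hU'closed : IsClosed (U' : Set (AlgebraicClosure K ≃ₐ[K] AlgebraicClosure K)) :=
    Subgroup.isClosed_of_isOpen _ hU'open
  have hU'normal : U'.Normal := hUnormal.map _ (absoluteGaloisGroup.toAlgEquiv K).surjective
  -- the fixed field `L = K̄^U`, finite abelian Galois over `K`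
  let L : IntermediateField K (AlgebraicClosure K) := IntermediateField.fixedField U'
  have hfix : L.fixingSubgroup = U' :=
    InfiniteGalois.fixingSubgroup_fixedField (⟨U', hU'closed⟩ : ClosedSubgroup _)
  haveI : FiniteDimensional K L :=
    (InfiniteGalois.isOpen_iff_finite L).mp (by rw [hfix]; exact hU'open)
  haveI : IsGalois K L := (InfiniteGalois.normal_iff_isGalois L).mp (by rw [hfix]; exact hU'normal)
  have hcomm : ∀ f g : L ≃ₐ[K] L, f * g = g * f := by
    intro f g
    obtain ⟨σ', rfl⟩ := AlgEquiv.restrictNormalHom_surjective (AlgebraicClosure K) f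
    obtain ⟨τ', rfl⟩ := AlgEquiv.restrictNormalHom_surjective (AlgebraicClosure K) g
    set ρ' : AlgebraicClosure K ≃ₐ[K] AlgebraicClosure K := σ' * τ' * σ'⁻¹ * τ'⁻¹ with hρ'
    have hmem : ρ' ∈ U' := by
      refine ⟨(absoluteGaloisGroup.toAlgEquiv K).symm ρ', ?_, ?_⟩
      · rw [SetLike.mem_coe, hρ', map_mul, map_mul, map_mul, map_inv, map_inv]
        exact hab _ _
      · exact (absoluteGaloisGroup.toAlgEquiv K).apply_symm_apply _
    have hone : AlgEquiv.restrictNormalHom L ρ' = 1 := by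
      ext x
      rw [AlgEquiv.one_apply]
      have hx : ρ' (x : AlgebraicClosure K) = x :=
        (IntermediateField.mem_fixedField_iff U' (x : AlgebraicClosure K)).mp x.2 _ hmem
      have hcommutes := AlgEquiv.restrictNormal_commutes ρ' L x
      change ((ρ'.restrictNormal L x : L) : AlgebraicClosure K) = ρ' (x : AlgebraicClosure K)
        at hcommutes
      rw [hx] at hcommutes
      exact hcommutes
    rw [hρ', map_mul, map_mul, map_mul, map_inv, map_inv, mul_inv_eq_one, mul_inv_eq_iff_eq_mul]
      at hone
    exact hone
  haveI : IsMulCommutative (L ≃ₐ[K] L) := ⟨⟨hcomm⟩⟩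
  haveI : IsAbelianGalois K L := IsAbelianGalois.mk
  -- Kronecker–Weber
  obtain ⟨m, hm0, hLm⟩ := hKW L inferInstance inferInstance
  refine ⟨m, hm0, fun σ hσ => ?_⟩
  have hσL : absoluteGaloisGroup.toAlgEquiv K σ ∈ L.fixingSubgroup := by
    rw [IntermediateField.mem_fixingSubgroup_iff]
    intro x hx
    exact (IntermediateField.forall_mem_adjoin_smul_eq_self_iff (F := K)
      (S := {ζ : AlgebraicClosure K | ζ ^ m = 1}) σ).mpr (fun ζ hζ => hσ ζ hζ) x (hLm hx)
  rw [hfix] at hσL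
  obtain ⟨ρ, hρU, hρσ⟩ := Subgroup.mem_map.mp hσL
  have hρ : ρ = σ := (absoluteGaloisGroup.toAlgEquiv K).injective hρσ
  rw [← hρ]
  exact hρU

omit [Fact p.Prime] in
/-- An element of `Γ_ℚ` whose mod `m` cyclotomic character is `1` fixes the `m`-th roots of
unity. [folklore] -/
theorem smul_eq_self_of_modNCyclotomicCharacter_eq_one {m : ℕ} [NeZero m] [NeZero (m : ℚ)]
    {τ : absoluteGaloisGroup ℚ} (hτ : (modNCyclotomicCharacter ℚ m τ : ZMod m) = 1)
    (ζ : AlgebraicClosure ℚ) (hζ : ζ ^ m = 1) : τ • ζ = ζ := by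
  have hm : 0 < m := Nat.pos_of_ne_zero (NeZero.ne m)
  rw [modNCyclotomicCharacter_spec ℚ m τ ζ hζ, hτ]
  rcases Nat.lt_or_ge 1 m with h1 | h1
  · rw [ZMod.val_one'' h1.ne', pow_one]
  · have hm1 : m = 1 := le_antisymm h1 hm
    subst hm1
    rw [pow_one] at hζ
    rw [hζ, one_pow]

end PadicallyAutomorphicDet

/-! ## 8. The determinant of complex conjugation -/

namespace BigHeckeGLn

namespace TameLevel

variable {n : ℕ} {p : ℕ} [Fact p.Prime]

open Literature.NumberTheory.GaloisRepresentations Field Rat.HeightOneSpectrum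
  PadicallyAutomorphicDet

/-- **Dirichlet primes for the estimate**: for every depth `N` and modulus `m ≥ 1` there is a prime
`l` outside the bad places with `l ≡ -1 (mod m ∏_{w ∈ S} q_w^N)` and `l > m` (Mathlib's Dirichlet
theorem `Nat.forall_exists_prime_gt_and_eq_mod`). [folklore] -/
theorem exists_prime_eq_neg_one_mod (𝒰 : TameLevel n ℚ p) (N : ℕ) {m : ℕ} (hm : 0 < m) :
    ∃ (l : ℕ) (v : HeightOneSpectrum (𝓞 ℚ)), l.Prime ∧
      ((primesEquiv v : Nat.Primes) : ℕ) = l ∧ Ideal.absNorm v.asIdeal = l ∧ v ∉ 𝒰.bad ∧ m < l ∧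
      m ∣ l + 1 ∧ ∀ w ∈ 𝒰.bad, ((primesEquiv w : Nat.Primes) : ℕ) ^ N ∣ l + 1 := by
  classical
  let Bd : Finset (HeightOneSpectrum (𝓞 ℚ)) := 𝒰.bad_finite.toFinset
  let B : ℕ := Bd.sup fun w => ((primesEquiv w : Nat.Primes) : ℕ)
  let P : ℕ := Bd.prod fun w => ((primesEquiv w : Nat.Primes) : ℕ) ^ N
  have hP0 : 0 < P := Finset.prod_pos fun w _ => pow_pos (primesEquiv w).2.pos _
  have hM0 : 0 < m * P := Nat.mul_pos hm hP0
  haveI : NeZero (m * P) := ⟨hM0.ne'⟩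
  obtain ⟨l, hlgt, hl, hlmod⟩ :=
    Nat.forall_exists_prime_gt_and_eq_mod (q := m * P) (a := (-1 : ZMod (m * P))) isUnit_one.neg
      (max B (m * P))
  have hlB : B < l := (le_max_left _ _).trans_lt hlgt
  have hlM : m * P < l := (le_max_right _ _).trans_lt hlgt
  have hml : m < l := lt_of_le_of_lt (Nat.le_mul_of_pos_right m hP0) hlM
  have hMdvd : m * P ∣ l + 1 := by
    rw [← ZMod.natCast_eq_zero_iff]
    push_cast
    rw [hlmod, neg_add_cancel]
  let v : HeightOneSpectrum (𝓞 ℚ) := (primesEquiv (R := 𝓞 ℚ)).symm ⟨l, hl⟩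
  have hvl : ((primesEquiv v : Nat.Primes) : ℕ) = l := by
    change ((primesEquiv ((primesEquiv (R := 𝓞 ℚ)).symm ⟨l, hl⟩) : Nat.Primes) : ℕ) = l
    rw [Equiv.apply_symm_apply]
  have hvbad : v ∉ 𝒰.bad := by
    intro h
    have hle : ((primesEquiv v : Nat.Primes) : ℕ) ≤ B :=
      Finset.le_sup (f := fun w => ((primesEquiv w : Nat.Primes) : ℕ)) (𝒰.bad_finite.mem_toFinset.2 h)
    rw [hvl] at hle
    exact absurd (hle.trans_lt hlB) (lt_irrefl _)
  have hnorm : Ideal.absNorm v.asIdeal = l := by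
    change Ideal.absNorm ((primesEquiv (R := 𝓞 ℚ)).symm ⟨l, hl⟩).asIdeal = l
    rw [Rat.asIdeal_primesEquiv_symm, Ideal.absNorm_span_natCast, NumberField.RingOfIntegers.rank,
      Module.finrank_self, pow_one]
  refine ⟨l, v, hl, hvl, hnorm, hvbad, hml, (Dvd.intro P rfl).trans hMdvd, fun w hw => ?_⟩
  exact ((Finset.dvd_prod_of_mem (fun w => ((primesEquiv w : Nat.Primes) : ℕ) ^ N)
    (𝒰.bad_finite.mem_toFinset.2 hw)).trans (Dvd.intro_left m rfl)).trans hMdvd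

omit [Fact p.Prime] in
/-- **`c · Frob_l` fixes `μ_m` when `l ≡ -1 (mod m)`**: the mod `m` cyclotomic character is `-1` on
a complex conjugation and `l` on an arithmetic Frobenius at `l ∤ m`. [folklore] -/
theorem smul_eq_self_of_isComplexConjugation_mul_frob {m : ℕ} [NeZero m] [NeZero (m : ℚ)]
    (hm : 0 < m) {l : ℕ} (hml : m < l) (hmdvd : m ∣ l + 1) {v : HeightOneSpectrum (𝓞 ℚ)}
    (hvl : ((primesEquiv v : Nat.Primes) : ℕ) = l) (hres : Ideal.absNorm v.asIdeal = l)
    {𝔓 : Ideal (absIntegers (𝓞 ℚ) ℚ)} (h𝔓 : 𝔓 ∈ v.primesAbove)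
    {σ : absoluteGaloisGroup ℚ} (hσ : IsArithFrobAt (𝓞 ℚ) σ 𝔓)
    {φ : ℚ →+* ℝ} {c : absoluteGaloisGroup ℚ} (hc : IsComplexConjugation φ c)
    (ζ : AlgebraicClosure ℚ) (hζ : ζ ^ m = 1) : (c * σ) • ζ = ζ := by
  refine smul_eq_self_of_modNCyclotomicCharacter_eq_one ?_ ζ hζ
  have hmP : ¬ ((primesEquiv v : Nat.Primes) : ℕ) ∣ m := by
    rw [hvl]
    exact Nat.not_dvd_of_pos_of_lt hm hml
  have hmσ : (modNCyclotomicCharacter ℚ m σ : ZMod m) = (l : ZMod m) := by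
    rw [modNCyclotomicCharacter_eq_residueCard_of_isArithFrobAt h𝔓
      (Rat.natCast_not_mem_of_mem_primesAbove_of_not_dvd h𝔓 hmP) hσ,
      HeightOneSpectrum.residueCard, hres]
  have hlm : ((l : ℕ) : ZMod m) = -1 := by
    have h0 : ((l + 1 : ℕ) : ZMod m) = 0 := (ZMod.natCast_eq_zero_iff _ _).2 hmdvd
    push_cast at h0
    exact eq_neg_of_add_eq_zero_left h0
  rw [map_mul, Units.val_mul, modNCyclotomicCharacter_of_isComplexConjugation hc, hmσ, hlm]
  ring

/-- **The key estimate.**  Let `x` be a continuous `ℚ̄_p`-point of `𝕋(K^p)` (`GL_n/ℚ`, tame level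
`𝒰`) and `Θ : Γ_ℚ → ℚ̄_pˣ` a continuous character with `Θ(Frob_v) = x(T_{v,n})` at every arithmetic
Frobenius of every good place `v`.  Then `‖Θ(c) - 1‖ < δ` for every complex conjugation `c` and
every `δ ∈ (0, 1]`: choose by Dirichlet a prime `l ≡ -1` modulo `m · ∏_{w ∈ S} q_w^N` (`m` from
Kronecker–Weber for `Θ mod N_δ`, `N` deeper than the level of the finitely many indices seen by
`x` at precision `δ` and than the congruence depth of `U` at the bad places); then
`x(T_{l,n})` is within `δ` of `1` (`heckeOperator_heckeElement_apply_eq_one`,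
`exists_finset_norm_sub_lt`) and `Θ(c) Θ(Frob_l) ∈ N_δ` (`c · Frob_l` fixes `μ_m`). [folklore] -/
theorem norm_coe_sub_one_lt_of_frob (𝒰 : TameLevel n ℚ p)
    {x : CompletedCohomologyHeckeAlgebraGLn 𝒰 →+* PadicAlgCl p} (hxc : Continuous x)
    (Θ : absoluteGaloisGroup ℚ →* (PadicAlgCl p)ˣ) (hΘc : Continuous Θ)
    (hΘfrob : ∀ v : HeightOneSpectrum (𝓞 ℚ), v ∉ 𝒰.bad → ∀ 𝔓 ∈ v.primesAbove,
      ∀ σ : absoluteGaloisGroup ℚ, IsArithFrobAt (𝓞 ℚ) σ 𝔓 →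
        (Θ σ : PadicAlgCl p) = x (𝒰.heckeT v n))
    {φ : ℚ →+* ℝ} {c : absoluteGaloisGroup ℚ} (hc : IsComplexConjugation φ c)
    {δ : ℝ} (hδ0 : 0 < δ) (hδ1 : δ ≤ 1) : ‖(Θ c : PadicAlgCl p) - 1‖ < δ := by
  classical
  -- (1) continuity of `x`
  obtain ⟨F, hF⟩ := exists_finset_norm_sub_lt 𝒰 hxc hδ0
  -- (2) a common congruence depth
  obtain ⟨c₀, hc₀⟩ := exists_forall_ofLocal_mem 𝒰
  let N₀ : ℕ := max (max c₀ 1) (F.sup fun idx => idx.1)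
  have hN₀1 : 1 ≤ N₀ := (le_max_right _ _).trans (le_max_left _ _)
  have hUN₀ : ∀ w ∈ 𝒰.bad, ∀ g ∈ localCongruenceSubgroup n ℚ w N₀, ofLocal n ℚ w g ∈ 𝒰.subgroup :=
    fun w hw g hg => hc₀ w hw g (localCongruenceSubgroup_antitone n ℚ w
      ((le_max_left _ _).trans (le_max_left _ _)) hg)
  -- (3) Kronecker–Weber for the open subgroup `Θ⁻¹(N_δ)` (the quotient embeds in `ℚ̄_pˣ/N_δ`)
  obtain ⟨Nδ, hNδ, hNδopen⟩ := exists_subgroup_norm_sub_one_lt p δ hδ0 hδ1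
  let H : Subgroup (absoluteGaloisGroup ℚ) := Nδ.comap Θ
  have hopen : IsOpen ((H : Subgroup (absoluteGaloisGroup ℚ)) : Set (absoluteGaloisGroup ℚ)) := by
    change IsOpen (Θ ⁻¹' ((Nδ : Subgroup (PadicAlgCl p)ˣ) : Set (PadicAlgCl p)ˣ))
    exact hNδopen.preimage hΘc
  have hab : ∀ a b : absoluteGaloisGroup ℚ, a * b * a⁻¹ * b⁻¹ ∈ H := fun a b => by
    have h1 : Θ (a * b * a⁻¹ * b⁻¹) = 1 := by
      rw [map_mul, map_mul, map_mul, map_inv, map_inv, mul_comm (Θ a) (Θ b), mul_inv_cancel_right,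
        mul_inv_cancel]
    change Θ (a * b * a⁻¹ * b⁻¹) ∈ Nδ
    rw [h1]
    exact one_mem _
  obtain ⟨m, hm, hmfix⟩ := exists_forall_smul_eq_self_imp_mem KroneckerWeber_holds H hopen hab
  haveI : NeZero m := ⟨hm.ne'⟩
  haveI : NeZero (m : ℚ) := ⟨Nat.cast_ne_zero.2 hm.ne'⟩
  -- (4) a Dirichlet prime `l ≡ -1` and an arithmetic Frobenius at it
  obtain ⟨l, v, hl, hvl, hres, hvbad, hml, hmdvd, hcong⟩ := exists_prime_eq_neg_one_mod 𝒰 N₀ hm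
  obtain ⟨𝔓, h𝔓⟩ := v.primesAbove_nonempty
  obtain ⟨σ, hσ⟩ := HeightOneSpectrum.exists_isArithFrobAt_of_mem_primesAbove_holds h𝔓
  have hΘσ : (Θ σ : PadicAlgCl p) = x (𝒰.heckeT v n) := hΘfrob v hvbad 𝔓 h𝔓 σ hσ
  -- (5) `x(T_{l,n})` is within `δ` of `1`
  have hT1 : ‖x (𝒰.heckeT v n) - 1‖ < δ := by
    have h := hF (𝒰.heckeT v n) 1 fun idx hidx => ?_
    · rwa [map_one] at h
    · rw [coe_heckeT 𝒰 hvbad, OneMemClass.coe_one, Pi.one_apply]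
      exact heckeOperator_heckeElement_apply_eq_one 𝒰 hN₀1 hUN₀ hl hvl hvbad hcong idx
        ((Finset.le_sup (f := fun idx : ℕ × ℕ × ℕ => idx.1) hidx).trans (le_max_right _ _))
  -- (6) the Galois side: `c · Frob_l` fixes `μ_m`, so `Θ(c) Θ(Frob_l) ∈ N_δ`
  have hHcσ : c * σ ∈ H :=
    hmfix (c * σ) (smul_eq_self_of_isComplexConjugation_mul_frob hm hml hmdvd hvl hres h𝔓 hσ hc)
  have hcσ : ‖(Θ c : PadicAlgCl p) * (Θ σ : PadicAlgCl p) - 1‖ < δ := by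
    have hmem : ‖((Θ (c * σ) : (PadicAlgCl p)ˣ) : PadicAlgCl p) - 1‖ < δ :=
      (hNδ _).1 (Subgroup.mem_comap.1 hHcσ)
    rw [map_mul, Units.val_mul] at hmem
    exact hmem
  -- (7) combine
  rw [hΘσ] at hcσ
  exact norm_sub_one_lt_of_norm_mul_sub_one_lt hδ1 hcσ hT1

/-- **The determinant of complex conjugation of a `p`-adically automorphic `ρ : Γ_ℚ → GL_n(ℚ̄_p)`
is `(-1)^{n(n-1)/2}`.**  Let `𝒰` be ANY `S`-good tame level for `GL_n/ℚ` at `p` and let `ρ` be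
associated (`charpoly ρ(Frob_l) = X^n - T_{l,1} X^{n-1} + … ± l^{n(n-1)/2} T_{l,n}`, `l ∉ S`)
with a continuous `ℚ̄_p`-point `x` of the completed-cohomology Hecke algebra `𝕋(K^p)`
(`IsPadicallyAutomorphic`).  Then `det ρ(c) = (-1)^{n(n-1)/2}` for every complex conjugation
`c ∈ Γ_ℚ`.  Proof (no Chebotarev, no Galois representation over `𝕋`): the continuous character
`Θ = det ρ · ε_p^{-n(n-1)/2}` has `Θ(Frob_l) = x(T_{l,n})` (`ε_p(Frob_l) = l`); `T_{l,n}` is the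
IDENTITY on `H^i(X_{U_r}, ℤ/p^s)`, `r ≤ N`, as soon as `l ≡ -1 (mod ∏_{w ∈ S} q_w^N)`
(`heckeOperator_heckeElement_apply_eq_one`: `-1 ∈ GL_n(ℚ)` is central and acts trivially on
`H^•(GL_n(ℚ), ·)`), so by continuity of `x`, `x(T_{l,n}) → 1` along such `l`; on the other hand
`Θ mod {‖u - 1‖ < δ}` has open kernel, hence factors through `Gal(ℚ(μ_m)/ℚ)` for some `m` by the
Kronecker–Weber theorem (`KroneckerWeber_holds`), where `c ↦ -1` and `Frob_l ↦ l`, so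
`‖Θ(c) Θ(Frob_l) - 1‖ < δ` for `l ≡ -1 (mod m)`; Dirichlet's theorem (Mathlib
`Nat.forall_exists_prime_gt_and_eq_mod`) supplies such primes `l ∉ S`, whence `‖Θ(c) - 1‖ < δ`
for every `δ`, `Θ(c) = 1` and `det ρ(c) = ε_p(c)^{n(n-1)/2} = (-1)^{n(n-1)/2}`.  For `n = 2` this
is the classical ODDNESS of the Galois representations attached to (`p`-adic, torsion, completed)
cohomology of modular curves: [cite: Pan2022LocallyAnalytic, §6.1.1] ("`ρ_λ : G_{ℚ,S} → GL₂(E)` …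
an odd semi-simple Galois representation … whose determinant is `λ ∘ D_S`"),
[cite: CalegariEmerton2011, §1.8]; for general `n` it is the determinant of the sign computed by
[cite: CaraianiLehung2016, Thm. 1.1] (`(-1)^{n(n-1)/2} = (-1)^{⌊n/2⌋}`). -/
theorem IsPadicallyAutomorphic.coe_det_apply_of_isComplexConjugation (𝒰 : TameLevel n ℚ p)
    {ρ : FramedGaloisRep ℚ (PadicAlgCl p) n} (hρ : 𝒰.IsPadicallyAutomorphic ρ)
    {φ : ℚ →+* ℝ} {c : absoluteGaloisGroup ℚ} (hc : IsComplexConjugation φ c) :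
    ((Matrix.GeneralLinearGroup.det (ρ c) : (PadicAlgCl p)ˣ) : PadicAlgCl p) =
      (-1) ^ (n * (n - 1) / 2) := by
  classical
  -- `n = 0`: both sides are `1`
  rcases Nat.eq_zero_or_pos n with hn0 | hnpos
  · subst hn0
    rw [Matrix.GeneralLinearGroup.val_det_apply, Matrix.det_isEmpty]
    simp
  have hn1 : 1 ≤ n := hnpos
  obtain ⟨x, hxc, hx⟩ := hρ
  obtain ⟨ε, hε⟩ := exists_cyclotomicCharacter_padicAlgCl_zpow ℚ p 1
  -- `Θ = det ρ · ε^{-e}`, `e = n(n-1)/2`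
  let Θ : absoluteGaloisGroup ℚ →* (PadicAlgCl p)ˣ :=
    (FramedRep.det ρ).toMonoidHom * (zpowGroupHom (-((n * (n - 1) / 2 : ℕ) : ℤ))).comp ε.toMonoidHom
  have hΘapply : ∀ τ, (Θ τ : PadicAlgCl p) =
      ((Matrix.GeneralLinearGroup.det (ρ τ) : (PadicAlgCl p)ˣ) : PadicAlgCl p) *
        ((ε τ : PadicAlgCl p) ^ (n * (n - 1) / 2))⁻¹ := by
    intro τ
    change (((FramedRep.det ρ).toMonoidHom τ *
      (zpowGroupHom (-((n * (n - 1) / 2 : ℕ) : ℤ))) (ε.toMonoidHom τ) : (PadicAlgCl p)ˣ) :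
        PadicAlgCl p) = _
    rw [zpowGroupHom_apply, Units.val_mul, Units.val_zpow_eq_zpow_val, zpow_neg, zpow_natCast]
    rfl
  have hΘcont : Continuous Θ := by
    have h1 : Continuous fun τ => FramedRep.det ρ τ := (FramedRep.det ρ).continuous
    have h2 : Continuous fun τ => (ε τ) ^ (-((n * (n - 1) / 2 : ℕ) : ℤ)) :=
      (continuous_zpow _).comp ε.continuous
    exact h1.mul h2
  have hΘfrob : ∀ v : HeightOneSpectrum (𝓞 ℚ), v ∉ 𝒰.bad → ∀ 𝔓 ∈ v.primesAbove,
      ∀ σ : absoluteGaloisGroup ℚ, IsArithFrobAt (𝓞 ℚ) σ 𝔓 →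
        (Θ σ : PadicAlgCl p) = x (𝒰.heckeT v n) := by
    intro v hvbad 𝔓 h𝔓 σ hσ
    have hvp : ((p : ℕ) : 𝓞 ℚ) ∉ v.asIdeal := fun h => hvbad (𝒰.mem_bad_of_mem v h)
    have hq0 : ((Ideal.absNorm v.asIdeal : ℕ) : PadicAlgCl p) ≠ 0 :=
      Nat.cast_ne_zero.2 fun h => v.ne_bot (Ideal.absNorm_eq_zero_iff.1 h)
    have hεσ : (ε σ : PadicAlgCl p) = ((Ideal.absNorm v.asIdeal : ℕ) : PadicAlgCl p) := by
      rw [coe_apply_of_isArithFrobAt_of_cyclotomic_zpow hε hvp h𝔓 hσ, zpow_one]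
      rfl
    rw [hΘapply σ, IsAssociated.coe_det_apply_of_isArithFrobAt 𝒰 hn1 hx hvbad h𝔓 hσ, hεσ,
      mul_assoc, mul_comm (x _), ← mul_assoc, mul_inv_cancel₀ (pow_ne_zero _ hq0), one_mul]
  have hΘc : (Θ c : PadicAlgCl p) = 1 :=
    eq_one_of_forall_norm_sub_one_lt fun δ hδ0 hδ1 =>
      norm_coe_sub_one_lt_of_frob 𝒰 hxc Θ hΘcont hΘfrob hc hδ0 hδ1
  have hεc : (ε c : PadicAlgCl p) = -1 := by
    rw [hε c, GaloisRep.cyclotomicCharacter_of_isComplexConjugation p hc]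
    simp
  rw [hΘapply c, hεc] at hΘc
  have hne : ((-1 : PadicAlgCl p) ^ (n * (n - 1) / 2)) ≠ 0 := pow_ne_zero _ (neg_ne_zero.2 one_ne_zero)
  calc ((Matrix.GeneralLinearGroup.det (ρ c) : (PadicAlgCl p)ˣ) : PadicAlgCl p)
      = ((Matrix.GeneralLinearGroup.det (ρ c) : (PadicAlgCl p)ˣ) : PadicAlgCl p) *
          ((-1 : PadicAlgCl p) ^ (n * (n - 1) / 2))⁻¹ * (-1 : PadicAlgCl p) ^ (n * (n - 1) / 2) := by
        rw [mul_assoc, inv_mul_cancel₀ hne, mul_one]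
    _ = (-1 : PadicAlgCl p) ^ (n * (n - 1) / 2) := by rw [hΘc, one_mul]

/-- **Units form**: `det ρ(c) = (-1)^{n(n-1)/2}` in `ℚ̄_pˣ`. [cite: CaraianiLehung2016, Thm. 1.1] -/
theorem IsPadicallyAutomorphic.det_apply_of_isComplexConjugation (𝒰 : TameLevel n ℚ p)
    {ρ : FramedGaloisRep ℚ (PadicAlgCl p) n} (hρ : 𝒰.IsPadicallyAutomorphic ρ)
    {φ : ℚ →+* ℝ} {c : absoluteGaloisGroup ℚ} (hc : IsComplexConjugation φ c) :
    Matrix.GeneralLinearGroup.det (ρ c) = (-1) ^ (n * (n - 1) / 2) :=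
  Units.ext (by
    rw [IsPadicallyAutomorphic.coe_det_apply_of_isComplexConjugation 𝒰 hρ hc, Units.val_pow_eq_pow_val,
      Units.val_neg, Units.val_one])

/-- **`p`-adically automorphic two-dimensional `ρ : Γ_ℚ → GL₂(ℚ̄_p)` are ODD** — at every prime `p`,
for every `S`-good tame level, with no hypothesis on the residual representation: `det ρ(c) = -1`
for every complex conjugation `c` (`FramedGaloisRep.IsOdd`).  This is the oddness of the Galois
representations attached to eigensystems in the completed cohomology of modular curves
([cite: Pan2022LocallyAnalytic, §6.1.1]: "`ρ_λ` … an odd semi-simple Galois representation";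
[cite: CalegariEmerton2011, §1.8]). -/
theorem IsPadicallyAutomorphic.isOdd (𝒰 : TameLevel 2 ℚ p)
    {ρ : FramedGaloisRep ℚ (PadicAlgCl p) 2} (hρ : 𝒰.IsPadicallyAutomorphic ρ) : ρ.IsOdd :=
  fun _ _ hc => by
    rw [IsPadicallyAutomorphic.det_apply_of_isComplexConjugation 𝒰 hρ hc]
    norm_num

end TameLevel

end BigHeckeGLn

end Literature.NumberTheory.Automorphic
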